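import Summits.ResolutionOfSingularities.ResolutionOfSingularities.Theorems.HilbertSamuelEliminationSigmaMaxModificationsCorridor3SigmaRowRunPFrame
import HarnessLib

/-!
# [OURS · L1 W4.2] ENGINE-I «ROW-P» — THE INSTANCE, FILE A′: the frame RELATIVISED TO A REACH-CLOSED SCOPE of row states (`RowRunFrame.ofRowGood`) and its
# incidence profile with LIVE `E⁻`-components (`RowEngine.incidenceGood`) — res-L1-w42-tri-2's (B-1) VACUITY FIX
# (cell res-hironaka, LADDER-RESOLUTION rung L; slot W4.2, crux chain w42 `SigmaMaxModificationsCorridor3` stmt-ResolutionOfSingularities-19249 / crux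
# stmt-…-18506; RULING v3.14-51a (51a-F), res-plan-2 DEAL #81 (1) → seat res-D-pv-060 g9; res-L1-w42-tri-2 FIRST-STEP FLAG (VACUITY) 21:45:21Z (B-1);
# `--supports stmt-ResolutionOfSingularities-19249 --as helper`, counted 0)

HONEST FRAMING. OURS bookkeeping over FILE A (`…Corridor3SigmaRowRunPFrame`, p574402). Nothing here is a statement of H. Hironaka's manuscript [Hironaka2017] (CANDIDATE,
never a premise) nor of [Cutkosky2009] (shapes only). Every `theorem` PROVED; the `def`s/`structure` are OURS bookkeeping. AI-written, weaker than expert review.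

WHY (tri-2 (B-1)). PART 2′'s `GuardedLaws` quantify over ALL states of a frame. Over `RowRunFrame.ofRow` (FILE A: `St := RowState`, EVERY scheme with any two
ideal sheaves and any list as «boundary») two of the geometric laws — `η ≤ 3`, «`E⁻`-components are non-empty» — are REFUTABLE (junk states: four copies of `⊥` in
`E⁻`; a member `⊤`), so FILE C's `guardedLaws_incidence` / `doneN_reach_incidence` (p574994) carry unsatisfiable hypotheses: VACUOUS AS TYPED (superseded here
by name; their PROVED parts — `incidence_eta_antitone`, `incidence_E_total`, … — are unaffected). Worse, with `Boundary.next` keeping a member whose strict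
transform is `⊤` (phase (A4) blows up a whole `E⁻`-component), FILE A's `eminusSets` acquires `∅` and (A4)'s row never exhausts. THIS FILE: (i) the SCOPE socket
`RowEngine.Scope` — a Reach-closed predicate `Good` on row states (`good_next`; contents pinned by the scheme side: `W` regular of dimension `3`, `E` snc with the
P-centres, top-row entry `IsTop`, … — FILE C already PROVES `isRegular_next` / `isTop_next` for two of them) — and the frame **`RowRunFrame.ofRowGood`** on the
subtype `{s // Good s}` (four axioms + `det` PROVED as in FILE A), so that every law downstream speaks of GOOD states only; (ii) **`RowState.eminusLive`** — the
`E⁻`-components as the supports of the LIVE old members only (non-empty BY DEFINITION; a member killed by (A4) leaves the point-set reading at once while `ℓ₀` and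
the list positions stay frozen); (iii) **`RowEngine.incidenceGood rd sc : PIncidenceS1 (RowRunFrame.ofRowGood m S₀ eng sc)`**. The sequel `…FrameGoodLaws`
re-derives the PROVED laws for the scoped frame, PROVES `Eminus_nonempty`, and assembles `GuardedLaws` from the remaining FIVE geometric laws stated over good
states (satisfiable: on a regular threefold with snc live `E⁻` at most three members pass through a point).

READINGS AS DATA vs LAWS (tri-1 (n1)): `RowReadings` stays uninterpreted DATA; every law a consumer needs about it (components are irreducible components of the
closure, non-empty; bad points are Thm 6.1 / Cor. 4.4's; labels injective on face curves, V5-5) is a NAMED HYPOTHESIS of the theorem that uses it (sequel), never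
silently assumed — a junk reading proves nothing about the engine because `IsEngineP` (FILE C `isEngineP_iff`) ties the readings to THE P-centre `γ`.

References: Cutkosky, Amer. J. Math. 131 (2009), Def. 5.4–5.5, Thm 7.2 [Cutkosky2009] (shapes only).
-/

set_option linter.dupNamespace false -- mandated namespace of this single-conjunct summit

noncomputable section

open CategoryTheory AlgebraicGeometry TopologicalSpace
open Literature.AlgebraicGeometry.Resolution Literature.AlgebraicGeometry.Cutkosky2009.DatumReduction
open Summit.ResolutionOfSingularities.ResolutionOfSingularities.Theorems.SigmaMaxModificationsCorridor3.Sigma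

namespace Summit.ResolutionOfSingularities.ResolutionOfSingularities.Theorems.SigmaMaxModificationsCorridor3.RowRunP

universe u

/-! ## §1 Live `E⁻`-components -/

namespace RowState

/-- **THE LIVE `E⁻`-COMPONENTS** of a row state: the supports of the old-epoch members that still have a point (a member whose strict transform became `⊤`
— phase (A4) — is no longer a component of the divisor `E⁻`, Def. 5.4's «effective divisor»). Non-empty by definition. [cite: Cutkosky2009, Def. 5.4 p. 18] -/
def eminusLive (s : RowState.{u}) : Set (Set (ULift.{u + 1} s.W)) :=
  {A | ∃ I ∈ s.Eminus, (s.liftSupport I).Nonempty ∧ A = s.liftSupport I}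

/-- A live component is non-empty. PROVED (by definition). [folklore] -/
theorem nonempty_of_mem_eminusLive (s : RowState.{u}) {A : Set (ULift.{u + 1} s.W)} (h : A ∈ s.eminusLive) : A.Nonempty := by
  obtain ⟨I, -, hne, rfl⟩ := h
  exact hne

/-- A live component is a component in FILE A's sense. [folklore] -/
theorem eminusLive_subset_eminusSets (s : RowState.{u}) : s.eminusLive ⊆ s.eminusSets := by
  rintro A ⟨I, hI, -, rfl⟩
  exact ⟨I, hI, rfl⟩

end RowState

/-! ## §2 The scope socket and the scoped frame -/

namespace RowEngine

variable {m S₀ : ℕ} (eng : RowEngine.{u} m S₀)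

/-- [OURS · L1 W4.2] **THE SCOPE OF A ROW P-RUN** (tri-2 (B-1)): a predicate `Good` on row states CLOSED UNDER THE ENGINE'S STEP on live states. Its contents are the
scheme side's standing hypotheses (regular threefold stage — `isRegular_next`; top-row entry — `isTop_next`; snc of the boundary with the P-centres; no junk
members), pinned by whoever discharges the geometric laws; the frame below only needs closure. NOT a statement of the manuscript. [folklore] -/
structure Scope : Type (u + 1) where
  /-- the good states -/
  Good : RowState.{u} → Prop
  /-- closure under one P-step on a live state -/
  good_next : ∀ s : RowState.{u}, Good s → (s.T m S₀).Nonempty → Good (eng.next s)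

end RowEngine

/-- [OURS · L1 W4.2] **THE `RowRunFrame` OF A ROW P-RUN, SCOPED** (supersedes `RowRunFrame.ofRow` as the carrier of the incidence laws): `St := {s // Good s}`, all other
data as in `RowRunFrame.ofRow` read on the underlying state; `progress` uses `good_next`. The four ELEMENTARY axioms PROVED. [folklore] -/
def RowRunFrame.ofRowGood (m S₀ : ℕ) (eng : RowEngine.{u} m S₀) (sc : eng.Scope) : RowRunFrame.{u + 1} where
  St := {s : RowState.{u} // sc.Good s}
  Pt s := ULift.{u + 1} s.1.W
  T s := {q | q.down ∈ s.1.T m S₀}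
  Stable s := eng.Stable s.1
  Move s s' := eng.Move s.1 s'.1
  centre {s _} _ := {q | q.down ∈ ((eng.γ s.1).support : Set s.1.W)}
  ptMap {s s'} h q :=
    ⟨(blowup.π (eng.γ s.1)).base (cast (congrArg (fun t : RowState.{u} => (↥t.W : Type u)) ((eng.move_iff _ _).mp h).2) q.down)⟩
  τ s q := eng.τ s.1 q.down
  Zlim c _ := eng.Zlim fun n => (c n).1
  topZlim c _ := eng.topZlim fun n => (c n).1
  proj c _ n z := ⟨eng.proj (fun n => (c n).1) n z⟩
  centre_subset {s _} h := fun q hq => eng.γ_subset s.1 ((eng.move_iff _ _).mp h).1 hq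
  centre_nonempty {s _} h := by
    obtain ⟨x, hx⟩ := eng.γ_nonempty s.1 ((eng.move_iff _ _).mp h).1
    exact ⟨⟨x⟩, hx⟩
  T_map {s s'} h q hq := by
    obtain ⟨s', hg'⟩ := s'
    have hne : (s.1.T m S₀).Nonempty := ((eng.move_iff _ _).mp h).1
    have e : s' = eng.next s.1 := ((eng.move_iff _ _).mp h).2
    subst e
    exact RowState.blowupAlong_T_map m S₀ s.1 (eng.γ s.1) (eng.ln_blowup s.1) _ (eng.γ_subset s.1 hne) q.down hq
  progress s h := by
    obtain ⟨q, hq⟩ := h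
    exact ⟨⟨eng.next s.1, sc.good_next s.1 s.2 ⟨q.down, hq⟩⟩, ⟨q.down, hq⟩, rfl⟩

namespace RowRunFrame

variable (m S₀ : ℕ) (eng : RowEngine.{u} m S₀) (sc : eng.Scope)

/-- **`det` for the scoped instance.** PROVED. [folklore] -/
theorem ofRowGood_det {s s₁ s₂ : (RowRunFrame.ofRowGood m S₀ eng sc).St} (h₁ : (RowRunFrame.ofRowGood m S₀ eng sc).Move s s₁)
    (h₂ : (RowRunFrame.ofRowGood m S₀ eng sc).Move s s₂) : s₁ = s₂ :=
  Subtype.ext (eng.move_det h₁ h₂)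

/-- Unfolding: a step of the scoped instance is an engine step of the underlying states. [folklore] -/
theorem ofRowGood_move_iff (s s' : (RowRunFrame.ofRowGood m S₀ eng sc).St) :
    (RowRunFrame.ofRowGood m S₀ eng sc).Move s s' ↔ (s.1.T m S₀).Nonempty ∧ s'.1 = eng.next s.1 :=
  Iff.rfl

end RowRunFrame

/-! ## §3 The incidence profile of the scoped instance (live `E⁻`-components) -/

namespace RowEngine

variable {m S₀ : ℕ} (eng : RowEngine.{u} m S₀)

/-- The scoped frame's (lifted) row stratum is finite iff the row stratum is. [folklore] -/
theorem finite_T_ofRowGood_iff (sc : eng.Scope) (s : (RowRunFrame.ofRowGood m S₀ eng sc).St) :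
    ((RowRunFrame.ofRowGood m S₀ eng sc).T s).Finite ↔ (s.1.T m S₀).Finite :=
  eng.finite_T_ofRow_iff s.1

/-- [OURS · L1 W4.2] **THE INCIDENCE PROFILE OF THE SCOPED INSTANCE** (S1′ form; supersedes `RowEngine.incidence`): as `incidence`, read on the underlying state, with
`Eminus := RowState.eminusLive` (LIVE components only) and the double curves `RowReadings.dblCurves`. [folklore] -/
noncomputable def incidenceGood (rd : RowReadings.{u}) (sc : eng.Scope) : RowRunFrame.PIncidenceS1 (RowRunFrame.ofRowGood m S₀ eng sc) where
  η s q := s.1.eta q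
  Eminus s := s.1.eminusLive
  E s := s.1.boundarySet
  dblCurves s := rd.dblCurves s.1
  curveCompsIn s A := rd.curveCompsIn s.1 A
  surfCompsIn s A := rd.surfCompsIn s.1 A
  badPts s 𝒞 := rd.badPts s.1 𝒞
  epoch s C := s.1.epochOf C
  after9 s := eng.After9 s.1
  after9_mono h hs := eng.after9_mono h hs
  after9_of_finite s hst hfin := eng.after9_of_finite s.1 hst ((eng.finite_T_ofRowGood_iff sc s).mp hfin)
  ownBadPts s C := rd.ownBadPts s.1 C
  lbl s C := rd.lbl s.1 C

/-- **THE ENGINE LAW for the scoped instance, unfolded**: one equation per GOOD live state, `liftSupport (γ s) = pCentre s` (res-L1-type-o1's bridge target).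
PROVED (unfolding). [folklore] -/
theorem isEngineP_incidenceGood_iff (rd : RowReadings.{u}) (sc : eng.Scope) :
    (eng.incidenceGood rd sc).IsEngineP ↔
      ∀ s : (RowRunFrame.ofRowGood m S₀ eng sc).St, (s.1.T m S₀).Nonempty →
        s.1.liftSupport (eng.γ s.1) = (eng.incidenceGood rd sc).pCentre s := by
  constructor
  · intro h s hs
    exact h (s' := ⟨eng.next s.1, sc.good_next s.1 s.2 hs⟩) ⟨hs, rfl⟩
  · intro h s s' hmv
    obtain ⟨s', hg'⟩ := s'
    have hs : (s.1.T m S₀).Nonempty := ((eng.move_iff _ _).mp hmv).1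
    have e : s' = eng.next s.1 := ((eng.move_iff _ _).mp hmv).2
    subst e
    exact h s hs

end RowEngine

end Summit.ResolutionOfSingularities.ResolutionOfSingularities.Theorems.SigmaMaxModificationsCorridor3.RowRunP

end
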